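import Mathlib

set_option linter.dupNamespace false -- `Summit.BirchSwinnertonDyer.BirchSwinnertonDyer.Theorems.…` (summit = sub)
set_option autoImplicit false

/-!
# Crux `HeegnerTwistCouplingInSupply` (stmt-BirchSwinnertonDyer-21381) — TOOLS for the transversality theorem over `𝔽₂`
# (unions of few subspaces, separating linear forms, dimension bookkeeping)

Route `BiquadraticEisensteinDescent` (cell `pub/bsd-wall`, width seat `bsd-wall-cm-bed-w3` g22; `--supports` 21381, helper). Tool file (1/2) of
the TRANSVERSALITY THEOREM `…SymbolicMonskyTransversal` (the abstract linear algebra behind the uniform existence of pattern-free Heegner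
recipes with `t = t₀` auxiliary primes, memo PATTERN-FREE-STRUCTURE-w3g21 §5 / this seat's memo THEOREM-A).

* §1 `exists_not_mem_of_two` / `exists_not_mem_of_three`: a module is not the union of two proper submodules, nor of three of which one has
  «codimension ≥ 2» (misses two elements and their sum) — elementary, any ring.
* §2 separating forms over `ZMod 2`: `exists_dual_one_zero`, `exists_pair_not_mem_dualAnnihilator_of_one_lt_finrank` (a subspace of dimension
  `> 1` has an annihilator of «codimension ≥ 2»), `exists_not_mem_dualAnnihilator_of_ne_bot`, unpacking lemmas; `x + x = 0`.
* §3 `finrank_map_add_finrank_inf_ker` (`dim X.map g + dim (X ⊓ ker g) = dim X`), `finrank_inf_ker_add_one` (a form not vanishing on `X`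
  cuts one dimension), injectivity of `b` on `W ⊓ ker a` when `ker a ⊓ ker b = ⊥`.

HONEST FRAMING: pure linear algebra; nothing about curves, the crux (C⁺), its stubs or BSD; nothing closed. THEOREMS ONLY.
-/

namespace Summit.BirchSwinnertonDyer.BirchSwinnertonDyer.Theorems.SymbolicMonsky

namespace Transversal

open Module Submodule

/-! ## §1 Unions of few subspaces -/

section Unions

variable {R M : Type*} [Ring R] [AddCommGroup M] [Module R M]

/-- Two proper submodules never cover a module. [folklore] -/
theorem exists_not_mem_of_two (U₁ U₂ : Submodule R M) (h₁ : ∃ x, x ∉ U₁) (h₂ : ∃ x, x ∉ U₂) :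
    ∃ v, v ∉ U₁ ∧ v ∉ U₂ := by
  obtain ⟨x, hx⟩ := h₁
  obtain ⟨y, hy⟩ := h₂
  by_cases hx2 : x ∈ U₂
  · by_cases hy1 : y ∈ U₁
    · refine ⟨x + y, fun h => hx ?_, fun h => hy ?_⟩
      · exact (Submodule.add_mem_iff_left U₁ hy1).mp h
      · exact (Submodule.add_mem_iff_right U₂ hx2).mp h
    · exact ⟨y, hy1, hy⟩
  · exact ⟨x, hx, hx2⟩

/-- Three submodules, two of them proper and one of «codimension ≥ 2» (it misses two elements AND their sum), never cover a
module. [folklore] -/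
theorem exists_not_mem_of_three (U₁ U₂ U₃ : Submodule R M) (h₁ : ∃ x, x ∉ U₁) (h₂ : ∃ x, x ∉ U₂)
    (h₃ : ∃ x y, x ∉ U₃ ∧ y ∉ U₃ ∧ x + y ∉ U₃) :
    ∃ v, v ∉ U₁ ∧ v ∉ U₂ ∧ v ∉ U₃ := by
  obtain ⟨g, hg1, hg2⟩ := exists_not_mem_of_two U₁ U₂ h₁ h₂
  by_cases hg3 : g ∈ U₃
  swap
  · exact ⟨g, hg1, hg2, hg3⟩
  by_contra H
  push Not at H
  -- every element outside `U₁ ∪ U₂` lies in `U₃`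
  have H' : ∀ v, v ∉ U₃ → v ∈ U₁ ∨ v ∈ U₂ := by
    intro v hv
    by_contra h
    push Not at h
    exact hv (H v h.1 h.2)
  -- key: `h ∉ U₃`, `h ∈ U₁` ⇒ `h ∉ U₂` and `g + h ∈ U₂` (and symmetrically)
  have keyA : ∀ h, h ∉ U₃ → h ∈ U₁ → (h ∉ U₂ ∧ g + h ∈ U₂) := by
    intro h hh3 hh1
    have hgh3 : g + h ∉ U₃ := fun hm => hh3 ((Submodule.add_mem_iff_right U₃ hg3).mp hm)
    have hgh1 : g + h ∉ U₁ := fun hm => hg1 ((Submodule.add_mem_iff_left U₁ hh1).mp hm)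
    rcases H' _ hgh3 with hm | hm
    · exact absurd hm hgh1
    · refine ⟨fun hh2 => hg2 ((Submodule.add_mem_iff_left U₂ hh2).mp hm), hm⟩
  have keyB : ∀ h, h ∉ U₃ → h ∈ U₂ → (h ∉ U₁ ∧ g + h ∈ U₁) := by
    intro h hh3 hh2
    have hgh3 : g + h ∉ U₃ := fun hm => hh3 ((Submodule.add_mem_iff_right U₃ hg3).mp hm)
    have hgh2 : g + h ∉ U₂ := fun hm => hg2 ((Submodule.add_mem_iff_left U₂ hh2).mp hm)
    rcases H' _ hgh3 with hm | hm
    · refine ⟨fun hh1 => hg1 ((Submodule.add_mem_iff_left U₁ hh1).mp hm), hm⟩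
    · exact absurd hm hgh2
  obtain ⟨p, q, hp, hq, hpq⟩ := h₃
  rcases H' _ hp with hp1 | hp2 <;> rcases H' _ hq with hq1 | hq2
  · -- both in U₁: then p+q ∈ U₁, so g+p+q ∈ U₂; with g+p ∈ U₂ get q ∈ U₂, contradiction
    have hpq1 : p + q ∈ U₁ := U₁.add_mem hp1 hq1
    obtain ⟨-, hgpq⟩ := keyA _ hpq hpq1
    obtain ⟨-, hgp⟩ := keyA _ hp hp1
    obtain ⟨hq2, -⟩ := keyA _ hq hq1
    apply hq2
    have : g + (p + q) - (g + p) = q := by abel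
    rw [← this]
    exact U₂.sub_mem hgpq hgp
  · -- p ∈ U₁, q ∈ U₂ : p + q ∉ U₁ ∪ U₂
    obtain ⟨hq1', -⟩ := keyB _ hq hq2
    obtain ⟨hp2', -⟩ := keyA _ hp hp1
    rcases H' _ hpq with hm | hm
    · exact hq1' ((Submodule.add_mem_iff_right U₁ hp1).mp hm)
    · exact hp2' ((Submodule.add_mem_iff_left U₂ hq2).mp hm)
  · obtain ⟨hp1', -⟩ := keyB _ hp hp2
    obtain ⟨hq2', -⟩ := keyA _ hq hq1
    rcases H' _ hpq with hm | hm
    · exact hp1' ((Submodule.add_mem_iff_left U₁ hq1).mp hm)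
    · exact hq2' ((Submodule.add_mem_iff_right U₂ hp2).mp hm)
  · have hpq2 : p + q ∈ U₂ := U₂.add_mem hp2 hq2
    obtain ⟨-, hgpq⟩ := keyB _ hpq hpq2
    obtain ⟨-, hgp⟩ := keyB _ hp hp2
    obtain ⟨hq1, -⟩ := keyB _ hq hq2
    apply hq1
    have : g + (p + q) - (g + p) = q := by abel
    rw [← this]
    exact U₁.sub_mem hgpq hgp

end Unions

/-! ## §2 Linear forms over `𝔽₂`: witnesses -/

section Duals

variable {V : Type*} [AddCommGroup V] [Module (ZMod 2) V]

/-- In `ZMod 2`, non-zero means `= 1`. [folklore] -/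
private theorem zmod2_ne_zero_iff (x : ZMod 2) : x ≠ 0 ↔ x = 1 := by
  revert x; decide

/-- A vector of an `𝔽₂`-space not in the span of another admits a form separating them. [folklore] -/
theorem exists_dual_one_zero {t t' : V} (h : t ∉ Submodule.span (ZMod 2) {t'}) :
    ∃ f : Dual (ZMod 2) V, f t = 1 ∧ f t' = 0 := by
  obtain ⟨f, hf, hmap⟩ := Submodule.exists_dual_map_eq_bot_of_notMem h inferInstance
  refine ⟨f, (zmod2_ne_zero_iff _).mp hf, ?_⟩
  have : f t' ∈ Submodule.map f (Submodule.span (ZMod 2) {t'}) :=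
    Submodule.mem_map_of_mem (Submodule.mem_span_singleton_self t')
  rw [hmap] at this
  simpa using this

/-- A non-zero vector admits a form not vanishing on it. [folklore] -/
theorem exists_dual_ne_zero {t : V} (h : t ≠ 0) : ∃ f : Dual (ZMod 2) V, f t ≠ 0 := by
  by_contra H
  push Not at H
  exact h ((Module.forall_dual_apply_eq_zero_iff (ZMod 2) t).mp H)

/-- The «codimension ≥ 2» witnesses for the annihilator of a subspace containing two independent vectors. [folklore] -/
theorem exists_pair_not_mem_dualAnnihilator (T : Submodule (ZMod 2) V) {t t' : V} (ht : t ∈ T) (ht' : t' ∈ T)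
    (h1 : t ∉ Submodule.span (ZMod 2) {t'}) (h2 : t' ∉ Submodule.span (ZMod 2) {t}) :
    ∃ f g : Dual (ZMod 2) V, f ∉ T.dualAnnihilator ∧ g ∉ T.dualAnnihilator ∧ f + g ∉ T.dualAnnihilator := by
  obtain ⟨f, hf1, hf0⟩ := exists_dual_one_zero h1
  obtain ⟨g, hg1, hg0⟩ := exists_dual_one_zero h2
  refine ⟨f, g, ?_, ?_, ?_⟩ <;> rw [Submodule.mem_dualAnnihilator] <;> push Not
  · exact ⟨t, ht, by rw [hf1]; decide⟩
  · exact ⟨t', ht', by rw [hg1]; decide⟩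
  · exact ⟨t, ht, by rw [LinearMap.add_apply, hf1, hg0]; decide⟩

/-- From `1 < finrank T`: two vectors of `T`, neither in the span of the other. [folklore] -/
theorem exists_pair_of_one_lt_finrank (T : Submodule (ZMod 2) V) (h : 1 < finrank (ZMod 2) T) :
    ∃ t t' : V, t ∈ T ∧ t' ∈ T ∧ t ∉ Submodule.span (ZMod 2) {t'} ∧ t' ∉ Submodule.span (ZMod 2) {t} := by
  haveI : Module.Finite (ZMod 2) T := Module.finite_of_finrank_pos (by omega)
  obtain ⟨x, hx0⟩ := (Module.finrank_pos_iff_exists_ne_zero (R := ZMod 2) (M := T)).mp (by omega)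
  obtain ⟨y, hxy⟩ := exists_linearIndependent_pair_of_one_lt_finrank h hx0
  have hxy' : LinearIndependent (ZMod 2) ![(x : V), (y : V)] := by
    have := hxy.map' T.subtype T.ker_subtype
    have hfun : (⇑T.subtype ∘ ![x, y]) = ![(x : V), (y : V)] := by
      ext i; fin_cases i <;> rfl
    rw [hfun] at this
    exact this
  rw [LinearIndependent.pair_iff] at hxy'
  refine ⟨x, y, x.2, y.2, ?_, ?_⟩
  · intro hm
    rw [Submodule.mem_span_singleton] at hm
    obtain ⟨c, hc⟩ := hm
    have := hxy' (-1) c (by rw [← hc]; module)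
    exact absurd this.1 (by decide)
  · intro hm
    rw [Submodule.mem_span_singleton] at hm
    obtain ⟨c, hc⟩ := hm
    have := hxy' c (-1) (by rw [← hc]; module)
    exact absurd this.2 (by decide)

/-- A subspace of dimension `> 1` gives an annihilator of «codimension ≥ 2» in the sense of `exists_not_mem_of_three`. [folklore] -/
theorem exists_pair_not_mem_dualAnnihilator_of_one_lt_finrank (T : Submodule (ZMod 2) V) (h : 1 < finrank (ZMod 2) T) :
    ∃ f g : Dual (ZMod 2) V, f ∉ T.dualAnnihilator ∧ g ∉ T.dualAnnihilator ∧ f + g ∉ T.dualAnnihilator := by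
  obtain ⟨t, t', ht, ht', h1, h2⟩ := exists_pair_of_one_lt_finrank T h
  exact exists_pair_not_mem_dualAnnihilator T ht ht' h1 h2

/-- A non-trivial subspace has a proper annihilator. [folklore] -/
theorem exists_not_mem_dualAnnihilator_of_ne_bot (T : Submodule (ZMod 2) V) (h : T ≠ ⊥) :
    ∃ f : Dual (ZMod 2) V, f ∉ T.dualAnnihilator := by
  obtain ⟨t, ht, ht0⟩ := (Submodule.ne_bot_iff T).mp h
  obtain ⟨f, hf⟩ := exists_dual_ne_zero ht0
  exact ⟨f, fun hm => hf ((Submodule.mem_dualAnnihilator f).mp hm t ht)⟩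

/-- Unfolding: a form outside the annihilator of `X.map g` gives `x ∈ X` with `f (g x) ≠ 0`. [folklore] -/
theorem exists_mem_ne_zero_of_not_mem {E : Type*} [AddCommGroup E] [Module (ZMod 2) E] (X : Submodule (ZMod 2) E)
    (g : E →ₗ[ZMod 2] V) {f : Dual (ZMod 2) V} (hf : f ∉ (X.map g).dualAnnihilator) : ∃ x ∈ X, f (g x) ≠ 0 := by
  rw [Submodule.mem_dualAnnihilator] at hf
  push Not at hf
  obtain ⟨v, hv, hfv⟩ := hf
  rw [Submodule.mem_map] at hv
  obtain ⟨x, hx, rfl⟩ := hv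
  exact ⟨x, hx, hfv⟩

/-- In an `𝔽₂`-space, `x + x = 0`. [folklore] -/
private theorem add_self_eq_zero_F2 (x : V) : x + x = 0 := by
  have h : (2 : ZMod 2) • x = 0 := by rw [show (2 : ZMod 2) = 0 from rfl, zero_smul]
  rwa [two_smul] at h

/-- In an `𝔽₂`-space, `x + y = 0 → x = y`. [folklore] -/
theorem eq_of_add_eq_zero_F2 {x y : V} (h : x + y = 0) : x = y := by
  calc x = x + (y + y) := by rw [add_self_eq_zero_F2, add_zero]
    _ = (x + y) + y := by rw [add_assoc]
    _ = y := by rw [h, zero_add]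

end Duals

/-! ## §3 Dimension bookkeeping -/

section Finrank

variable {E V : Type*} [AddCommGroup E] [Module (ZMod 2) E] [AddCommGroup V] [Module (ZMod 2) V]
  [FiniteDimensional (ZMod 2) E]

/-- `dim (X.map g) + dim (X ⊓ ker g) = dim X`. [folklore] -/
theorem finrank_map_add_finrank_inf_ker (X : Submodule (ZMod 2) E) (g : E →ₗ[ZMod 2] V) :
    finrank (ZMod 2) (X.map g) + finrank (ZMod 2) ↥(X ⊓ LinearMap.ker g) = finrank (ZMod 2) X := by
  have h1 : LinearMap.range (g.domRestrict X) = X.map g := LinearMap.range_domRestrict X g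
  have h2 : LinearMap.ker (g.domRestrict X) = (X ⊓ LinearMap.ker g).comap X.subtype := by
    rw [LinearMap.ker_domRestrict, Submodule.comap_inf, Submodule.comap_subtype_self, top_inf_eq]
  have h3 : finrank (ZMod 2) ↥((X ⊓ LinearMap.ker g).comap X.subtype) = finrank (ZMod 2) ↥(X ⊓ LinearMap.ker g) :=
    (Submodule.comapSubtypeEquivOfLe (inf_le_left : X ⊓ LinearMap.ker g ≤ X)).finrank_eq
  have := LinearMap.finrank_range_add_finrank_ker (g.domRestrict X)
  rw [h1, h2, h3] at this
  exact this

/-- A form not vanishing on `X` cuts its dimension by one: `dim (X ⊓ ker φ) + 1 = dim X`. [folklore] -/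
theorem finrank_inf_ker_add_one (X : Submodule (ZMod 2) E) (φ : Dual (ZMod 2) E) (h : ∃ x ∈ X, φ x ≠ 0) :
    finrank (ZMod 2) ↥(X ⊓ LinearMap.ker φ) + 1 = finrank (ZMod 2) X := by
  have hm : finrank (ZMod 2) (X.map φ) = 1 := by
    apply le_antisymm
    · calc finrank (ZMod 2) (X.map φ) ≤ finrank (ZMod 2) (ZMod 2) := Submodule.finrank_le _
        _ = 1 := Module.finrank_self (ZMod 2)
    · obtain ⟨x, hx, hφ⟩ := h
      have : (X.map φ) ≠ ⊥ := by
        rw [Submodule.ne_bot_iff]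
        exact ⟨φ x, Submodule.mem_map_of_mem hx, hφ⟩
      have hne : finrank (ZMod 2) (X.map φ) ≠ 0 := fun h0 => this (Submodule.finrank_eq_zero.mp h0)
      omega
  have := finrank_map_add_finrank_inf_ker X φ
  rw [hm] at this
  omega

/-- Monotonicity form: `dim (X ⊓ Y) ≤ dim X`. [folklore] -/
theorem finrank_inf_le_left (X Y : Submodule (ZMod 2) E) : finrank (ZMod 2) ↥(X ⊓ Y) ≤ finrank (ZMod 2) X :=
  Submodule.finrank_mono inf_le_left

end Finrank


/-! ## §4 The step: a good linear form -/

section Step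

variable {E V : Type*} [AddCommGroup E] [Module (ZMod 2) E] [AddCommGroup V] [Module (ZMod 2) V]
variable (a b : E →ₗ[ZMod 2] V)

/-- In `ZMod 2`: `x + y ≠ 0 ↔ x ≠ y`. [folklore] -/
theorem zmod2_add_ne_zero_iff (x y : ZMod 2) : x + y ≠ 0 ↔ x ≠ y := by
  revert x y; decide

/-- Unpacking a form outside the annihilator of `(W ⊓ ker g).map h`. [folklore] -/
theorem exists_mem_ker_ne_zero (W : Submodule (ZMod 2) E) (g h : E →ₗ[ZMod 2] V) {f : Dual (ZMod 2) V}
    (hf : f ∉ ((W ⊓ LinearMap.ker g).map h).dualAnnihilator) : ∃ w ∈ W, g w = 0 ∧ f (h w) ≠ 0 := by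
  obtain ⟨w, hw, hfw⟩ := exists_mem_ne_zero_of_not_mem _ h hf
  rw [Submodule.mem_inf, LinearMap.mem_ker] at hw
  exact ⟨w, hw.1, hw.2, hfw⟩

variable [FiniteDimensional (ZMod 2) E]

/-- `b` is injective on `W ⊓ ker a` when `ker a ⊓ ker b = ⊥`: the image has the same dimension. [folklore] -/
theorem finrank_map_inf_ker_eq (hab : LinearMap.ker a ⊓ LinearMap.ker b = ⊥) (W : Submodule (ZMod 2) E) :
    finrank (ZMod 2) ((W ⊓ LinearMap.ker a).map b) = finrank (ZMod 2) ↥(W ⊓ LinearMap.ker a) := by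
  have h := finrank_map_add_finrank_inf_ker (W ⊓ LinearMap.ker a) b
  have h0 : W ⊓ LinearMap.ker a ⊓ LinearMap.ker b = ⊥ := by
    rw [eq_bot_iff, ← hab, inf_assoc]
    exact inf_le_right
  rw [h0, finrank_bot, add_zero] at h
  exact h

/-- `a` is injective on `W ⊓ ker (a + b)` when `ker a ⊓ ker b = ⊥`. [folklore] -/
theorem finrank_map_inf_ker_add_eq (hab : LinearMap.ker a ⊓ LinearMap.ker b = ⊥) (W : Submodule (ZMod 2) E) :
    finrank (ZMod 2) ((W ⊓ LinearMap.ker (a + b)).map a) = finrank (ZMod 2) ↥(W ⊓ LinearMap.ker (a + b)) := by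
  have h := finrank_map_add_finrank_inf_ker (W ⊓ LinearMap.ker (a + b)) a
  have h0 : W ⊓ LinearMap.ker (a + b) ⊓ LinearMap.ker a = ⊥ := by
    rw [eq_bot_iff]
    intro x hx
    rw [Submodule.mem_inf, Submodule.mem_inf, LinearMap.mem_ker, LinearMap.mem_ker, LinearMap.add_apply] at hx
    have hb : b x = 0 := by
      have := hx.1.2
      rw [hx.2, zero_add] at this
      exact this
    have : x ∈ LinearMap.ker a ⊓ LinearMap.ker b := Submodule.mem_inf.mpr ⟨hx.2, hb⟩
    rw [hab] at this
    exact this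
  rw [h0, finrank_bot, add_zero] at h
  exact h

/-- `dim (W.map g) = dim W − dim (W ⊓ ker g)`. [folklore] -/
theorem finrank_map_eq_sub (W : Submodule (ZMod 2) E) (g : E →ₗ[ZMod 2] V) :
    finrank (ZMod 2) (W.map g) = finrank (ZMod 2) W - finrank (ZMod 2) ↥(W ⊓ LinearMap.ker g) := by
  have := finrank_map_add_finrank_inf_ker W g
  omega

end Step

end Transversal

end Summit.BirchSwinnertonDyer.BirchSwinnertonDyer.Theorems.SymbolicMonsky
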